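import Summits.AnomalousDissipation.AnomalousDissipation.Theorems.TwoAndHalfDTwohalfdThesisStubCoherenceOfEnergy
import Literature.Analysis.FluidPDE.PassiveScalarClassicalEnergy
import Literature.Analysis.FluidPDE.PassiveScalarClassicalWeak
import Literature.Analysis.FunctionSpaces.TorusSpaceTimeFields

/-!
# R4 `stub_noQuietWindow`: no quiet windows — a lossy release costs kinetic action on its window

Stub R4 of the line `Sketch` (duhamel-release) for the crux
`Summit.AnomalousDissipation.AnomalousDissipation.Theses.TwoAndHalfD.TwohalfdThesis`
(stmt-AnomalousDissipation-0206); the statement is registered verbatim on the item.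

CONTENT. Let `κ ≥ 0`, let `h` be a smooth pattern on `T²`, and let `φ` be a classical solution of
the UNFORCED advection–diffusion equation `∂ₜφ + u·∇φ = κΔφ`, `div u = 0`, on the window
`[s, s + τ₀] × T²` (`τ₀ ≥ 0`) released from `φ(s) = h`. If the release has lost the fraction `δ` of
`‖h‖²_{L²}` by age `τ₀`, `‖φ(s + τ₀)‖² ≤ (1 - δ)‖h‖²`, then the window carried kinetic action:

  `‖h‖_{L²} (1 - √(1 - δ)) ≤ ‖∇h‖_{L^∞} ∫_s^{s+τ₀} ‖u(r)‖_{L²} dr + κ τ₀ ‖Δh‖_{L²}`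

(no sign hypothesis on `δ`; `√` is `Real.sqrt`, vanishing on negatives).

PROOF. The datum correlation `D(r) := ∫ h φ(r)` is differentiable within `[s, s + τ₀]` with
`D'(r) = κ ∫ (Δh) φ(r) + ∫ ⟪u(r), ∇h⟫ φ(r)` (F1's `hasDerivWithinAt_integral_mul_release`:
the equation, Green's second identity, the transport identity for `div u = 0`). Cauchy–Schwarz
(F1's `neg_sqrt_mul_sqrt_le_integral_laplacian_mul`, `neg_iSup_mul_le_integral_inner_gradient_mul`)
and the `L²` contraction `‖φ(r)‖ ≤ ‖h‖` (`IsClassicalScalarTransportOn.antitoneOn_scalarL2Sq`,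
`κ ≥ 0`) give `D'(r) ≥ -‖h‖ (κ‖Δh‖ + ‖∇h‖_∞ ‖u(r)‖_{L²})`; the derivative is continuous on the
compact window (space integrals of jointly smooth integrands), so the fundamental theorem of
calculus (`intervalIntegral.integral_eq_sub_of_hasDerivAt_of_le`) and monotonicity of the interval
integral give `D(s + τ₀) ≥ ‖h‖² - ‖h‖ R`, `R` the displayed right-hand side. On the other hand
`D(s + τ₀) ≤ ‖h‖ ‖φ(s + τ₀)‖ ≤ ‖h‖ √(1 - δ) ‖h‖` (Cauchy–Schwarz and the loss). Hence
`‖h‖² (1 - √(1 - δ)) ≤ ‖h‖ R`; divide by `‖h‖` (if `‖h‖ = 0` the claim is `0 ≤ R`).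
Supports stmt-AnomalousDissipation-0206. [folklore: DEIJ 2022, §1 (1.1)–(1.3); Evans 2010,
App. C.2 Thms. 2–3]
-/

noncomputable section

-- the summit path `AnomalousDissipation/AnomalousDissipation` duplicates a namespace component
set_option linter.dupNamespace false

namespace Summit.AnomalousDissipation.AnomalousDissipation.Theorems.TwohalfdThesis

open MeasureTheory Set Filter Topology
open scoped ENNReal NNReal InnerProductSpace
open Literature.Analysis.FunctionSpaces Literature.Analysis.FluidPDE

variable {d : Type*} [Fintype d] [DecidableEq d]

/-! ## The lower bound on the derivative of the datum correlation -/

/-- **Time-resolved lower bound on `D'`.** For a classical solution `φ` of `∂ₜφ + u·∇φ = κΔφ`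
(`κ ≥ 0`) on `[a, b] × T^d` released from the smooth datum `φ(a) = h`, at every `r ∈ [a, b]`
`κ ∫ (Δh) φ(r) + ∫ ⟪u(r), ∇h⟫ φ(r) ≥ -‖h‖_{L²} (κ ‖Δh‖_{L²} + (sup ‖∇h‖) ‖u(r)‖_{L²})`
(Cauchy–Schwarz for both terms and the `L²` contraction `‖φ(r)‖ ≤ ‖φ(a)‖ = ‖h‖`). [folklore] -/
theorem noQuietWindow_neg_le_deriv {κ a b : ℝ} {u : ℝ → UnitAddTorus d → EuclideanSpace ℝ d}
    {h : UnitAddTorus d → ℝ} {φ : ℝ → UnitAddTorus d → ℝ} (hκ : 0 ≤ κ) (hh : Torus.IsSmooth h)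
    (hφ : Torus.IsClassicalScalarTransportOn (Icc a b) κ u φ) (hφa : φ a = h) {r : ℝ}
    (hr : r ∈ Icc a b) :
    -(√(Torus.scalarL2Sq h) * (κ * √(Torus.scalarL2Sq (Torus.laplacian h)) +
        (⨆ x, ‖Torus.gradient h x‖) * √(∫ x, ‖u r x‖ ^ 2))) ≤
      κ * (∫ x, Torus.laplacian h x * φ r x) + ∫ x, ⟪u r x, Torus.gradient h x⟫_ℝ * φ r x := by
  set A := √(Torus.scalarL2Sq (Torus.laplacian h)) with hA_def
  set G := ⨆ x, ‖Torus.gradient h x‖ with hG_def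
  set N := √(Torus.scalarL2Sq h) with hN_def
  set V := √(∫ x, ‖u r x‖ ^ 2) with hV_def
  have hA0 : 0 ≤ A := Real.sqrt_nonneg _
  have hG0 : 0 ≤ G := Real.iSup_nonneg fun x => norm_nonneg _
  have hV0 : 0 ≤ V := Real.sqrt_nonneg _
  have hab : a ≤ b := hr.1.trans hr.2
  have hφr : Torus.IsSmooth (φ r) := hφ.smooth_scalar.isSmooth_slice hr
  have hur : Torus.IsSmooth (u r) := hφ.smooth_velocity.isSmooth_slice hr
  -- the `L²` contraction `‖φ(r)‖ ≤ ‖φ(a)‖ = ‖h‖`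
  have hL2 : Torus.scalarL2Sq (φ r) ≤ Torus.scalarL2Sq h := by
    have hanti := hφ.antitoneOn_scalarL2Sq hκ (Subset.refl (Icc a b))
    have e := hanti (left_mem_Icc.2 hab) hr hr.1
    simpa only [hφa] using e
  have hNr : √(Torus.scalarL2Sq (φ r)) ≤ N := Real.sqrt_le_sqrt hL2
  have hsφ : 0 ≤ √(Torus.scalarL2Sq (φ r)) := Real.sqrt_nonneg _
  have h1 := neg_sqrt_mul_sqrt_le_integral_laplacian_mul hh hφr
  have h2 := neg_iSup_mul_le_integral_inner_gradient_mul hur hh hφr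
  -- (a) the diffusive term
  have ha : -(κ * A * N) ≤ κ * ∫ x, Torus.laplacian h x * φ r x := by
    have e : κ * (A * √(Torus.scalarL2Sq (φ r))) ≤ κ * (A * N) :=
      mul_le_mul_of_nonneg_left (mul_le_mul_of_nonneg_left hNr hA0) hκ
    nlinarith [mul_le_mul_of_nonneg_left h1 hκ]
  -- (b) the stirring term
  have hb : -(G * V * N) ≤ ∫ x, ⟪u r x, Torus.gradient h x⟫_ℝ * φ r x := by
    have e : G * (V * √(Torus.scalarL2Sq (φ r))) ≤ G * (V * N) :=
      mul_le_mul_of_nonneg_left (mul_le_mul_of_nonneg_left hNr hV0) hG0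
    linarith
  linarith

/-! ## The integrated lower bound on the datum correlation -/

/-- **Coherence with time-resolved energy.** For a classical solution `φ` of
`∂ₜφ + u·∇φ = κΔφ` (`κ ≥ 0`) on `[a, b] × T^d` (`a ≤ b`) released from the smooth datum
`φ(a) = h`:
`‖h‖² - ‖h‖_{L²} ((sup ‖∇h‖) ∫ₐᵇ ‖u(r)‖_{L²} dr + κ (b - a) ‖Δh‖_{L²}) ≤ ∫ h φ(b)`.
Proof: the correlation `D(r) = ∫ h φ(r)` has `D(a) = ‖h‖²` and the continuous derivative
`κ ∫ (Δh) φ + ∫ ⟪u, ∇h⟫ φ` within `[a, b]` (`hasDerivWithinAt_integral_mul_release`), bounded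
below by `noQuietWindow_neg_le_deriv`; integrate (fundamental theorem of calculus,
`intervalIntegral.integral_eq_sub_of_hasDerivAt_of_le`, and `intervalIntegral.integral_mono_on`,
the speed `r ↦ ‖u(r)‖_{L²}` being continuous on the window). The degenerate window `a = b` is
trivial. [folklore] -/
theorem noQuietWindow_sub_le_integral_mul {κ a b : ℝ}
    {u : ℝ → UnitAddTorus d → EuclideanSpace ℝ d} {h : UnitAddTorus d → ℝ}
    {φ : ℝ → UnitAddTorus d → ℝ} (hκ : 0 ≤ κ) (hh : Torus.IsSmooth h) (hab : a ≤ b)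
    (hφ : Torus.IsClassicalScalarTransportOn (Icc a b) κ u φ) (hφa : φ a = h) :
    Torus.scalarL2Sq h - √(Torus.scalarL2Sq h) *
        ((⨆ x, ‖Torus.gradient h x‖) * (∫ r in a..b, √(∫ x, ‖u r x‖ ^ 2)) +
          κ * (b - a) * √(Torus.scalarL2Sq (Torus.laplacian h))) ≤
      ∫ x, h x * φ b x := by
  set A := √(Torus.scalarL2Sq (Torus.laplacian h)) with hA_def
  set G := ⨆ x, ‖Torus.gradient h x‖ with hG_def
  set N := √(Torus.scalarL2Sq h) with hN_def
  set V : ℝ → ℝ := fun r => √(∫ x, ‖u r x‖ ^ 2) with hV_def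
  have hCa : ∫ x, h x * φ a x = Torus.scalarL2Sq h := by
    simp only [hφa, Torus.scalarL2Sq, sq]
  rcases eq_or_lt_of_le hab with rfl | hab'
  · -- the degenerate window
    rw [intervalIntegral.integral_same, sub_self, hCa]
    simp
  -- the correlation and its derivative within `[a, b]`
  have hU : UniqueDiffOn ℝ (Icc a b) := uniqueDiffOn_Icc hab'
  set D' : ℝ → ℝ := fun r => κ * (∫ x, Torus.laplacian h x * φ r x) +
      ∫ x, ⟪u r x, Torus.gradient h x⟫_ℝ * φ r x with hD'_def
  have hder : ∀ r ∈ Icc a b,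
      HasDerivWithinAt (fun τ => ∫ x, h x * φ τ x) (D' r) (Icc a b) r := fun r hr =>
    hasDerivWithinAt_integral_mul_release (convex_Icc a b) hU hh hφ hr
  -- the derivative is continuous on the window, hence interval integrable
  have hD'cont : ContinuousOn D' (Icc a b) := by
    have h1 : Torus.IsSmoothSpaceTimeOn (Icc a b) (fun r x => Torus.laplacian h x * φ r x) :=
      (Torus.isSmoothSpaceTimeOn_const hh.laplacian _).mul hφ.smooth_scalar
    have h2 : Torus.IsSmoothSpaceTimeOn (Icc a b)
        (fun r x => ⟪u r x, Torus.gradient h x⟫_ℝ * φ r x) :=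
      (hφ.smooth_velocity.inner (Torus.isSmoothSpaceTimeOn_const hh.gradient _)).mul
        hφ.smooth_scalar
    exact (continuousOn_const.mul (h1.continuousOn_integral (convex_Icc a b))).add
      (h2.continuousOn_integral (convex_Icc a b))
  have hD'int : IntervalIntegrable D' volume a b :=
    (hD'cont.mono (uIcc_of_le hab).subset).intervalIntegrable
  have hFTC : ∫ r in a..b, D' r = (∫ x, h x * φ b x) - ∫ x, h x * φ a x :=
    intervalIntegral.integral_eq_sub_of_hasDerivAt_of_le hab
      (fun r hr => (hder r hr).continuousWithinAt)
      (fun r hr => (hder r (Ioo_subset_Icc_self hr)).hasDerivAt (Icc_mem_nhds hr.1 hr.2))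
      hD'int
  -- the lower bound on the derivative, integrated over the window
  have hbound : ∀ r ∈ Icc a b, -(N * (κ * A + G * V r)) ≤ D' r := fun r hr =>
    noQuietWindow_neg_le_deriv hκ hh hφ hφa hr
  have hVcont : ContinuousOn V (Icc a b) :=
    Real.continuous_sqrt.comp_continuousOn
      (Torus.continuousOn_integral_norm_sq_of_continuousOn_stLift
        hφ.smooth_velocity.continuousOn_stLift)
  have hVint : IntervalIntegrable V volume a b :=
    (hVcont.mono (uIcc_of_le hab).subset).intervalIntegrable
  have hBint : IntervalIntegrable (fun r => -(N * (κ * A + G * V r))) volume a b := by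
    have hc : ContinuousOn (fun r => -(N * (κ * A + G * V r))) (Icc a b) :=
      (continuousOn_const.mul (continuousOn_const.add (continuousOn_const.mul hVcont))).neg
    exact (hc.mono (uIcc_of_le hab).subset).intervalIntegrable
  have hmono : ∫ r in a..b, -(N * (κ * A + G * V r)) ≤ ∫ r in a..b, D' r :=
    intervalIntegral.integral_mono_on hab hBint hD'int hbound
  have hval : ∫ r in a..b, -(N * (κ * A + G * V r)) =
      -(N * (κ * A * (b - a) + G * ∫ r in a..b, V r)) := by
    rw [intervalIntegral.integral_neg, intervalIntegral.integral_const_mul,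
      intervalIntegral.integral_add intervalIntegrable_const (hVint.const_mul G),
      intervalIntegral.integral_const, intervalIntegral.integral_const_mul, smul_eq_mul]
    ring
  rw [hCa] at hFTC
  have key : Torus.scalarL2Sq h - N * (κ * A * (b - a) + G * ∫ r in a..b, V r) ≤
      ∫ x, h x * φ b x := by
    linarith
  calc Torus.scalarL2Sq h - N * (G * (∫ r in a..b, V r) + κ * (b - a) * A)
      = Torus.scalarL2Sq h - N * (κ * A * (b - a) + G * ∫ r in a..b, V r) := by ring
    _ ≤ ∫ x, h x * φ b x := key

/-! ## The stub: no quiet windows -/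

/-- **R4 `stub_noQuietWindow` (line `Sketch` = duhamel-release, crux `TwoAndHalfD.TwohalfdThesis`):
no quiet windows.** For a classical solution `φ` of `∂ₜφ + u·∇φ = κΔφ` (`κ ≥ 0`) on
`[s, s + τ₀] × T²` (`τ₀ ≥ 0`) released from the smooth pattern `φ(s) = h` and losing the fraction
`δ` of `‖h‖²` by age `τ₀`, `‖φ(s + τ₀)‖² ≤ (1 - δ)‖h‖²`:
`‖h‖_{L²} (1 - √(1 - δ)) ≤ (sup ‖∇h‖) ∫_s^{s+τ₀} ‖u(r)‖_{L²} dr + κ τ₀ ‖Δh‖_{L²}` — a lossy release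
costs kinetic action on its own window (no sign hypothesis on `δ`). Proof: the correlation
`D(r) = ∫ h φ(r)` obeys `D(s + τ₀) ≥ ‖h‖² - ‖h‖ R` (`noQuietWindow_sub_le_integral_mul`: FTC for
its continuous derivative, Cauchy–Schwarz, the `L²` contraction) and
`D(s + τ₀) ≤ ‖h‖ ‖φ(s + τ₀)‖ ≤ ‖h‖ √(1 - δ) ‖h‖` (Cauchy–Schwarz and the loss); divide by `‖h‖`
(the case `‖h‖ = 0` reads `0 ≤ R`). [folklore] -/
theorem stub_noQuietWindow :
    ∀ (κ s τ₀ δ : ℝ) (u : ℝ → (UnitAddTorus (Fin 2)) → (EuclideanSpace ℝ (Fin 2))) (h : (UnitAddTorus (Fin 2)) → ℝ)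
      (φ : ℝ → (UnitAddTorus (Fin 2)) → ℝ),
      0 ≤ κ → Torus.IsSmooth h → 0 ≤ τ₀ →
      Torus.IsClassicalScalarTransportOn (Icc s (s + τ₀)) κ u φ → φ s = h →
      Torus.scalarL2Sq (φ (s + τ₀)) ≤ (1 - δ) * Torus.scalarL2Sq h →
      Real.sqrt (Torus.scalarL2Sq h) * (1 - Real.sqrt (1 - δ)) ≤
        (⨆ x, ‖Torus.gradient h x‖) * (∫ r in s..(s + τ₀), Real.sqrt (∫ x, ‖u r x‖ ^ 2)) +
          κ * τ₀ * Real.sqrt (Torus.scalarL2Sq (Torus.laplacian h)) := by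
  intro κ s τ₀ δ u h φ hκ hh hτ₀ hφ hφs hloss
  set A := Real.sqrt (Torus.scalarL2Sq (Torus.laplacian h)) with hA_def
  set G := ⨆ x, ‖Torus.gradient h x‖ with hG_def
  set N := Real.sqrt (Torus.scalarL2Sq h) with hN_def
  set I := ∫ r in s..(s + τ₀), Real.sqrt (∫ x, ‖u r x‖ ^ 2) with hI_def
  have hsb : s ≤ s + τ₀ := by linarith
  have hA0 : 0 ≤ A := Real.sqrt_nonneg _
  have hG0 : 0 ≤ G := Real.iSup_nonneg fun x => norm_nonneg _
  have hN0 : 0 ≤ N := Real.sqrt_nonneg _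
  have hI0 : 0 ≤ I := intervalIntegral.integral_nonneg hsb fun r _ => Real.sqrt_nonneg _
  have hR0 : 0 ≤ G * I + κ * τ₀ * A :=
    add_nonneg (mul_nonneg hG0 hI0) (mul_nonneg (mul_nonneg hκ hτ₀) hA0)
  -- the lower bound on the correlation at age `τ₀` (FTC)
  have hlow : Torus.scalarL2Sq h - N * (G * I + κ * τ₀ * A) ≤ ∫ x, h x * φ (s + τ₀) x := by
    have e := noQuietWindow_sub_le_integral_mul hκ hh hsb hφ hφs
    have e2 : s + τ₀ - s = τ₀ := by ring
    rw [e2] at e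
    exact e
  -- the upper bound on the correlation at age `τ₀` (Cauchy–Schwarz and the loss)
  have hup : ∫ x, h x * φ (s + τ₀) x ≤ N * (Real.sqrt (1 - δ) * N) := by
    have hφb : Torus.IsSmooth (φ (s + τ₀)) :=
      hφ.smooth_scalar.isSmooth_slice (right_mem_Icc.2 hsb)
    have hcs : ∫ x, h x * φ (s + τ₀) x ≤ N * √(Torus.scalarL2Sq (φ (s + τ₀))) :=
      ScalarAnomalySteadySourceFormal.ColdStartVariance.integral_mul_le_sqrt_mul_sqrt
        (hh.memLp 2) (hφb.memLp 2)
    have hsq : √(Torus.scalarL2Sq (φ (s + τ₀))) ≤ Real.sqrt (1 - δ) * N :=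
      calc √(Torus.scalarL2Sq (φ (s + τ₀)))
          ≤ √((1 - δ) * Torus.scalarL2Sq h) := Real.sqrt_le_sqrt hloss
        _ = Real.sqrt (1 - δ) * N := Real.sqrt_mul' _ (Torus.scalarL2Sq_nonneg h)
    exact hcs.trans (mul_le_mul_of_nonneg_left hsq hN0)
  -- combine and divide by `‖h‖`
  have hNN : N * N = Torus.scalarL2Sq h := Real.mul_self_sqrt (Torus.scalarL2Sq_nonneg h)
  have hkey : N * (N * (1 - Real.sqrt (1 - δ))) ≤ N * (G * I + κ * τ₀ * A) := by
    linarith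
  rcases eq_or_lt_of_le hN0 with hN | hNpos
  · rw [← hN, zero_mul]
    exact hR0
  · exact le_of_mul_le_mul_left hkey hNpos

end Summit.AnomalousDissipation.AnomalousDissipation.Theorems.TwohalfdThesis

end
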